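import Mathlib
import HarnessLib
import Literature.Analysis.FluidPDE.TypeIAncientMild
import Literature.Analysis.FluidPDE.TypeIAncientMildClassical
import Literature.Analysis.FluidPDE.ClassicalSolution

/-!
# Sketch — crux-ideate FarPastLedger (stmt-NavierStokesRegularity-14060), ideator 2, round 1

First lemmas of the two idea cards, stated over existing declarations only
(`Literature.Analysis.FluidPDE.IsTypeIAncientMild`, `IsClassicalNSSolutionOn`, Mathlib). Nothing is
proved here; the file must elaborate (`lean check` rc 0).
-/

noncomputable section

open MeasureTheory Set Metric Real

namespace Summit.NavierStokesRegularity.NavierStokesRegularity.Cruxes.FarPastLedger.Ideator2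

abbrev E3 := EuclideanSpace ℝ (Fin 3)

open Literature.Analysis.FluidPDE

/-! ## Card `one-scale-gronwall-ledger` -/

/-- The near/far pressure-oscillation structure on every ball (Robinson–Rodrigo–Sadowski Lemma 15.12
with the outer radius sent to infinity; the tree proves the finite-radius form
`setLIntegral_pressure_oscillation_le`). This is the ONLY pressure input the Gronwall consumes;
card `mean-acceleration-gauge` supplies it, or the existing stub `stub_knssPressure` does. -/
def NearFarPressureOsc (u : ℝ → E3 → E3) (p : ℝ → E3 → ℝ) (S : Set ℝ) : Prop :=
  ∃ C₀ : ℝ, ∀ t ∈ S, ∀ (x₀ : E3) (r : ℝ), 0 < r →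
    ∫ x in ball x₀ r, |p t x - ⨍ y in ball x₀ r, p t y| ^ (3 / 2 : ℝ) ≤
      C₀ * ((∫ x in ball x₀ (2 * r), ‖u t x‖ ^ 3) +
        r ^ (9 / 2 : ℝ) * (∫ y in (ball x₀ (2 * r))ᶜ, ‖u t y‖ ^ 2 / ‖y - x₀‖ ^ 4) ^ (3 / 2 : ℝ))

/-- **First lemma of card 1 (flux linearisation at one scale).** For `u ∈ A_C` with a classical
pressure on a window carrying the near/far oscillation structure, the cut-off energy at ONE centre
grows, between two times of the parabolic window `[-4R², 0)`, at most by `∫ a(τ) e(τ) dτ` for ANY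
majorant `e` of the `R`-ball energies over all centres, with the coefficient
`a(τ) = c/R² + c·C/(R√(-τ)) + c·C^{4/3} R^{1/3} (-τ)^{-2/3} / R` whose integral over the window is
`O(1 + C + C^{4/3})` — every flux (viscous, cubic, near pressure, far pressure via one
Cauchy–Schwarz per dyadic shell) linearised against the Type-I bound `‖u(τ)‖∞ ≤ C/√(-τ)`.
Gronwall in `e(τ) := sup_b ∫ φ_b |u(τ)|²` then gives the ledger with `K(C) = c C² exp(c(1+C+C^{4/3}))`. -/
def LedgerFluxLinearisation : Prop :=
  ∀ C : ℝ, ∃ c : ℝ, ∀ (u : ℝ → E3 → E3) (p : ℝ → E3 → ℝ) (t₀ : ℝ), t₀ < 0 →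
    IsTypeIAncientMild C u → IsClassicalNSSolutionOn (Ioo t₀ 0) 1 0 u p →
    NearFarPressureOsc u p (Ioo t₀ 0) →
    ∀ (R : ℝ) (b : E3) (φ : E3 → ℝ), 0 < R →
      ContDiff ℝ (⊤ : ℕ∞) φ → (∀ x, 0 ≤ φ x ∧ φ x ≤ 1) → (∀ x ∉ ball b (2 * R), φ x = 0) →
      (∀ x ∈ ball b R, φ x = 1) → (∀ x, ‖fderiv ℝ φ x‖ ≤ 1 / R) →
      (∀ x, |Laplacian.laplacian φ x| ≤ 1 / R ^ 2) →
    ∀ (τ₁ τ₂ : ℝ) (e : ℝ → ℝ), t₀ < τ₁ → -4 * R ^ 2 ≤ τ₁ → τ₁ < τ₂ → τ₂ < 0 →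
      ContinuousOn e (Icc τ₁ τ₂) →
      (∀ τ ∈ Icc τ₁ τ₂, ∀ b' : E3, ∫ x in ball b' R, ‖u τ x‖ ^ 2 ≤ e τ) →
      ∫ x, φ x * ‖u τ₂ x‖ ^ 2 ≤ ∫ x, φ x * ‖u τ₁ x‖ ^ 2 +
        ∫ τ in τ₁..τ₂, (c / R ^ 2 + c * C / (R * Real.sqrt (-τ))) * e τ +
          c * C ^ (4 / 3 : ℝ) * R ^ (1 / 3 : ℝ) * (-τ) ^ (-(2 / 3 : ℝ)) * (e τ / R + 1)

/-- The ledger itself in the form the Gronwall delivers it (for the record: this is the crux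
`SymmetryModuliCount.FarPastLedger` once `NearFarPressureOsc` is discharged on every window). -/
def LedgerFromOscillation : Prop :=
  ∀ C : ℝ, ∃ K : ℝ, ∀ (u : ℝ → E3 → E3), IsTypeIAncientMild C u →
    (∀ t₀ < 0, ∃ p : ℝ → E3 → ℝ, IsClassicalNSSolutionOn (Ioo t₀ 0) 1 0 u p ∧
      NearFarPressureOsc u p (Ioo t₀ 0)) →
    ∀ t < 0, ∀ (x₀ : E3) (R : ℝ), 0 < R → ∫ x in ball x₀ R, ‖u t x‖ ^ 2 ≤ K * R

/-! ## Card `mean-acceleration-gauge` -/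

/-- **First lemma of card 2 (mean displacement vanishes at large scales).** For `u ∈ A_C` and
`s < t < 0`, the weighted large-ball averages of the displacement `u(t) - u(s)` tend to `0`,
uniformly in the centre: the caloric part `(e^{(t-s)Δ} - 1)u(s)` is an exact divergence of a field
bounded by `2√(t-s)·C/√(-s)`, and the Duhamel part has the exact-divergence kernel `K = ∇·𝒪`
(Oseen tensor `|𝒪_σ(z)| ≲ (√σ+|z|)⁻³`, near field) with `|K| ≲ |z|⁻⁴` (far field). This is the
one place the Oseen identity (H3) is used; from it the affine pressure mode — minus the far-field
mean acceleration — vanishes, and the classical pressure has sublinear oscillation. -/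
def MeanDisplacementVanishes : Prop :=
  ∀ (C : ℝ) (u : ℝ → E3 → E3), IsTypeIAncientMild C u →
    ∀ (χ : E3 → ℝ), ContDiff ℝ (⊤ : ℕ∞) χ → HasCompactSupport χ →
    ∀ s t : ℝ, s < t → t < 0 → ∀ ε > 0, ∃ ρ₀ : ℝ, 0 < ρ₀ ∧ ∀ ρ ≥ ρ₀, ∀ x₀ : E3,
      ‖∫ x, χ (ρ⁻¹ • (x - x₀)) • (u t x - u s x)‖ ≤ ε * ρ ^ 3

/-- **Second statement of card 2 (sublinear pressure oscillation = the gauge lemma).** The classical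
pressure of `u ∈ A_C` on a window has oscillation `o(L)` on balls of radius `L`, uniformly in the
centre, at every time of the window. (Parasitic `b(t)`: oscillation exactly linear — excluded.) -/
def SublinearPressureOscillation : Prop :=
  ∀ (C : ℝ) (u : ℝ → E3 → E3) (p : ℝ → E3 → ℝ) (t₀ : ℝ), t₀ < 0 →
    IsTypeIAncientMild C u → IsClassicalNSSolutionOn (Ioo t₀ 0) 1 0 u p →
    ∀ t ∈ Ioo t₀ 0, ∀ ε > 0, ∃ L₀ : ℝ, 0 < L₀ ∧ ∀ L ≥ L₀, ∀ x₀ x : E3, x ∈ ball x₀ L →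
      |p t x - p t x₀| ≤ ε * L

/-- **Third statement of card 2 (the consumer form).** Sublinear oscillation feeds the tree's
finite-radius RRS estimate `setLIntegral_pressure_oscillation_le` with outer radius `ρ → ∞`
(its tail `(r/ρ)^{9/2} ∫_{B_ρ} (|u|³ + |p - c|^{3/2}) → 0`), giving `NearFarPressureOsc`. -/
def OscillationOfSublinear : Prop :=
  ∀ (C : ℝ) (u : ℝ → E3 → E3) (p : ℝ → E3 → ℝ) (t₀ : ℝ), t₀ < 0 →
    IsTypeIAncientMild C u → IsClassicalNSSolutionOn (Ioo t₀ 0) 1 0 u p →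
    (∀ t ∈ Ioo t₀ 0, ∀ ε > 0, ∃ L₀ : ℝ, 0 < L₀ ∧ ∀ L ≥ L₀, ∀ x₀ x : E3, x ∈ ball x₀ L →
      |p t x - p t x₀| ≤ ε * L) →
    NearFarPressureOsc u p (Ioo t₀ 0)

/-- The pressure input on windows, in the form `LedgerFromOscillation` consumes (card 2 delivers it
as `exists_isClassicalNSSolutionOn_Ioo` + `SublinearPressureOscillation` + `OscillationOfSublinear`;
the existing line's `stub_knssPressure` also implies it). -/
def PressureInputOnWindows : Prop :=
  ∀ (C : ℝ) (u : ℝ → E3 → E3), IsTypeIAncientMild C u →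
    ∀ t₀ < 0, ∃ p : ℝ → E3 → ℝ, IsClassicalNSSolutionOn (Ioo t₀ 0) 1 0 u p ∧
      NearFarPressureOsc u p (Ioo t₀ 0)

/-- Card 2's three statements give the pressure input (pure logic + the tree's classical pressure
`IsTypeIAncientMild.exists_isClassicalNSSolutionOn_Ioo`). Kernel-checked. -/
theorem pressureInputOnWindows_of (hS : SublinearPressureOscillation) (hO : OscillationOfSublinear) :
    PressureInputOnWindows := by
  intro C u hu t₀ ht₀
  obtain ⟨p, hp⟩ := hu.exists_isClassicalNSSolutionOn_Ioo ht₀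
  exact ⟨p, hp, hO C u p t₀ ht₀ hu hp (hS C u p t₀ ht₀ hu hp)⟩

/-- The crux signature, pasted VERBATIM from the ledger (`ledger workitem get stmt-...-14060`,
payload.signature) — the farm's build of `Theses/SymmetryModuliCount.lean` predates the rev that added
`FarPastLedger` (by-name probe: Unknown identifier, as the refuter refute-pool-g48 also found), so the
composition below targets this literal copy; it is definitionally the route decl. -/
def FarPastLedger_sig : Prop :=
  ∀ C : ℝ, ∃ K : ℝ, ∀ (u : ℝ → EuclideanSpace ℝ (Fin 3) → EuclideanSpace ℝ (Fin 3)), Literature.Analysis.FluidPDE.IsTypeIAncientMild C u → ∀ t < 0, ∀ (x₀ : EuclideanSpace ℝ (Fin 3)) (R : ℝ), 0 < R → ∫ x in Metric.ball x₀ R, ‖u t x‖ ^ 2 ≤ K * R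

/-- The two cards compose to the crux (pure logic; kernel-checked against the verbatim signature):
the Gronwall form of the ledger plus the pressure input on windows is `FarPastLedger`. -/
theorem farPastLedger_of (hL : LedgerFromOscillation) (hP : PressureInputOnWindows) :
    FarPastLedger_sig := by
  intro C
  obtain ⟨K, hK⟩ := hL C
  exact ⟨K, fun u hu t ht x₀ R hR => hK u hu (fun t₀ ht₀ => hP C u hu t₀ ht₀) t ht x₀ R hR⟩

end Summit.NavierStokesRegularity.NavierStokesRegularity.Cruxes.FarPastLedger.Ideator2
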